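import Mathlib
import Summits.MatrixMultiplication.MatrixMultiplication.Theses.LevelGradedCohnUmans
import Summits.MatrixMultiplication.MatrixMultiplication.Theorems.LieRankDesigns.Negative.Basics
import Literature.Barriers.MatrixMultiplication.NormalizerBarrier
import Literature.RepresentationTheory.FiniteGroups.GLnCharacterDegreeBound
import Summits.MatrixMultiplication.MatrixMultiplication.Theorems.LevelGradedCohnUmansSubgroupIdentityDesignsStubLowerPiece
import Summits.MatrixMultiplication.MatrixMultiplication.Theorems.LevelGradedCohnUmansSubgroupIdentityDesignsStubUpperPiece
import Summits.MatrixMultiplication.MatrixMultiplication.Theorems.LevelGradedCohnUmansSubgroupIdentityDesignsStubSharpBudgetOfGreen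

/-!
# Line `levi-free-rigid-outer-pieces` for the crux `SubgroupIdentityDesigns` (stmt-MatrixMultiplication-14079)

Skeleton (crux-plan, round 1) of idea card `Cruxes/SubgroupIdentityDesigns/Ideas/levi-free-rigid-outer-pieces.md`
(triage r1: pass 3/3; sharpenings of TRIAGE-r1-1/2/3 built in, see `Lines/levi-free-rigid-outer-pieces.md`).

## The line in one paragraph
The graded normaliser / stabiliser counts of `Disproof.lean` (landed: `Negative/GradedNormalizerCount`,
`Negative/StabilizerCount`) say that a level-`k` subgroup identity design in `GL_m(𝔽_p)` must have OUTER
pieces `H₁, H₃` that are normalised by (almost) nothing in the middle and whose normalisers in `G` have index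
`≳ √W` — "Levi-free" — while tori may live INSIDE the outer pieces unpenalised.  The constructive answer of the
card: the RIGID OUTER PAIR
`H₁ = T₁ ⋉ U⁻_{cols ≤ k} = {[[u⁻, 0], [X, t₁]]}`, `H₃ = T₃ ⋉ U⁺_{rows ≤ k} = {[[u⁺, Z], [0, t₃]]}` in
`GL_{k+r}(𝔽_p)`, `k = 2ℓ`, `r = ℓ n`, with `u^∓` lower/upper unitriangular `k × k`, `X ∈ M_{r×k}`, `Z ∈ M_{k×r}`
arbitrary, and `T₁, T₃ ≤ GL_r(𝔽_p)` FIXED-POINT-FREE tori of order `≥ p^{ℓ-1}` meeting trivially (intended: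
the scalar-free subfield tori `𝔽_{p^ℓ}^× / 𝔽_p^×` acting by scalars on `𝔽_{p^ℓ}^n = 𝔽_p^r` through two
`𝔽_{p^ℓ}`-structures in general position, `gcd(ℓ, p-1) = 1`).  Then `|H₁| = |H₃| = p^{C(k,2)+rk}|T_i| ≥ p^{2ℓ²(n+1)-1}
= √W_k / p^{1+o(1)}` (`W_k = N_k ≈ p^{2mk-k²} = p^{4ℓ²(n+1)}`), the normalisers are `P^∓ ⋊ (torus × ΓL_n(p^ℓ))`
(index `≫ √W`), and what is left OPEN is ONE choice: a transverse middle group `H₂` of order `≥ c·p^{2ℓ²(n+1)-a}`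
with the subgroup TPP and the level-`k` identity test.  With the SHARP level-`k` budget
`B_s ≤ C^s p^{s(mk-k²/2-k/2)+k}` the exponent gap is `ℓ ε − (2+ε)(2+a)/3 > 0` for `ℓ > (2+ε)(2+a)/(3ε)`, so a
`k`-family with any FIXED power loss `a` gives the crux for every `ε` (kernel-checked below:
`SubgroupIdentityDesigns_of`).

## Registered stubs (5) and the composition
* `stub_lowerPiece`  (M)  — the lower rigid piece `{[[u⁻,0],[X,t]] : t ∈ T}` is a subgroup of `GL_{k+r}(𝔽_p)`
  (closure under products; finite ⇒ subgroup) of order `p^{C(k,2) + rk} · |T|`, for EVERY `T ≤ GL_r(𝔽_p)`.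
* `stub_upperPiece`  (M)  — the same for the upper piece `{[[u⁺,Z],[0,t]] : t ∈ T}` (transpose of the lower one).
* `stub_green` (named fact `GreenGLnDegreeBound`, blocked: Green 1955 is statement-only in the tree) and
  `stub_sharpBudget_of_green` (L) — together the sharp level-`k` budget of `GL_m(𝔽_p)` (`stub_sharpBudget`):
  `Σ_{χ ∈ Irr ∩ F_k} χ(1)^s ≤ C_{m,k}^s · p^{s(mk - k²/2 - k/2) + k}` (`1 ≤ k`, `2k ≤ m`, `s ≥ 2`).  Route to it
  (all three pieces classical): SHARP DEGREE `χ(1) ≤ 2^{m+k} p^{mk-k²/2-k/2}` for `χ ∈ Irr ∩ F_k` (tree: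
  `Theorems.LieRankDesigns.stub_sharpLevelDegree`, landed CONDITIONAL on Green's bound
  `deg ≤ 2^n p^{n(n-1)/2}` for `GL_n(𝔽_p)`) × PLANCHEREL IN `F_k` (`Σ_{Irr ∩ F_k} χ(1)² ≤ dim F_k`, bi-invariance
  + simplicity of the Wedderburn blocks; cf. `Negative/GradedPlancherel`, `GradedPricing` line) × the count
  `dim F_k ≤ N_k ≤ C p^{2mk-k²}` (`finrank_levelSubmodule_le` + Gaussian binomials):
  `Σ χ(1)^s ≤ d_max^{s-2} Σ χ(1)² ≤ C^{s-2} p^{(s-2)(mk-k²/2-k/2)} · C' p^{2mk-k²}` and `2mk-k² = 2(mk-k²/2-k/2)+k`.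
  The landed `CellBudget` (`cellBudget_of_stubs`, loss `(p-1)^{-(s-2)/2}` only) is NOT enough for this line
  (it needs the full `p^{-(s-2)(k-1)/2}`): the budget stub is load-bearing.
* `stub_rigidDesigns` (XL, HARDEST, the line's bet) — for some fixed loss `a`, for unboundedly many `ℓ`, some
  `n ≥ 2`, `c > 0` and unboundedly many primes `p`: fixed-point-free tori `T₁, T₃ ≤ GL_{ℓn}(𝔽_p)` of order
  `≥ p^{ℓ-1}` such that the rigid outer pair `(H₁, H₃)` they define admits a middle group `H₂` of order
  `≥ c p^{2ℓ²(n+1) - a}` with `SubgroupTPP H₁ H₂ H₃` and the level-`2ℓ` identity test.  Internal milestones, in the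
  order the triage and `Disproof.lean` dictate (each a `stub-add` candidate once `(ℓ, n, T₁, T₃, H₂)` are chosen):
  (M1) the OUTER PAIR passes the pair test `δ_1 ∈ F_k|_{H₁H₃}` — necessary by `Disproof.no_idTest_of_pair_circuit` /
  `outer_pair_independent` (no tensor circuit `θ₁ ⊗ θ₃` over `Irr(H₁) × Irr(H₃)`), Clifford-elementary for these
  pieces (TRIAGE-r1-1); (M2) a SCALAR-FREE transverse middle with subgroup TPP against the explicit block-LDU
  family `H₁H₃ = {[[u⁻u⁺, u⁻Z],[Xu⁺, XZ + t₁t₃]]}` and `H₂ ∩ (N(H₁) ∪ N(H₃)) = 1` (TRIAGE-r1-2 (i),(ii); generic for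
  `n ≥ 3`, `3(mk - k²/2) < m²`), whose Levi double-coset footprint stays within `p^{O(1)}` of
  `U_k⁻U_k⁺ × T₁T₃` (TRIAGE-r1-3); (M3) the middle criterion M11 (`Disproof.mid_criterion`, a `|H₂|`-unknown
  linear system) and the certified rank (`Negative/TriangularCount`); (M4) the identity test proper through the
  isotypic systems over `Irr(H₁) × Irr(H₃)` (card ghost-calculus-chebotarev = the engine).
* `SubgroupIdentityDesigns_of : LowerPieceStmt → UpperPieceStmt → SharpBudgetStmt → RigidDesignsStmt →
  SubgroupIdentityDesigns` — the ε-bookkeeping, PROVED (no `sorry`): choose `ℓ > (2+ε)(2+a)/(3ε)`, then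
  `p > K^{1/δ}` with `K = C^s / c^{s/3}`, `δ = ℓε - (2+ε)(2+a)/3`; `subgroupIdentityDesigns_of_stubs` feeds the four
  registered stubs into it (type check that the stub signatures ARE the named statements).

## Lead's reshape (prover-line-stmt-MatrixMultiplication-14079-a1-0, cycle 1)
* Budget: the registered unconditional `stub_sharpBudget` needs the SHARP maximal degree of `GL_k(𝔽_p)`; it is
  split into `stub_green` (= the tree's named fact `GreenGLnDegreeBound`, no proof available) and the provable
  `stub_sharpBudget_of_green`; `stub_sharpBudget` is now the one-line derived theorem feeding the composition.
* `stub_rigidDesigns`, milestone M1 (outer-pair test), first finding (lead, evidence `M1-levi-collision.md`): the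
  rigid pair FAILS the pair test as soon as some `t ≠ t'` in `T₁T₃` has `rk(t − t') ≤ 2(r − k)` (`r = ℓn`,
  `k = 2ℓ`): an explicit level-`k` annihilator `Σ_{X,Z} ψ(tr γX + tr βZ)(δ_{[1,Z;X,XZ+t]} − δ_{[1,Z;X,XZ+t']})`
  lives on `H₁H₃` whenever `γ (t − t') β = 0` for some rank-`k` pair `γ ∈ M_{k×r}`, `β ∈ M_{r×k}`.  Hence every
  witness has `n ≤ 3` (for `n ≥ 4`, `r ≥ 2k` and EVERY `t ∈ T₁ ∖ 1` collides with `1`), and at `n = 3` the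
  product set `T₁T₃ ∖ 1` must consist of elements with fixed space of dimension `≤ ℓ − 1`; the card's intended
  regime `n ≥ 2k` is dead.  The stub as registered (`∃ n ≥ 2`) is unaffected in form; its witnesses are confined
  to `n ∈ {2, 3}`.

## Disproof used (Cruxes/SubgroupIdentityDesigns/Disproof.lean v4, read 2026-08-16T17Z)
`not_subgroupIdentityDesigns_of_le_normalizer`, `volume_le_card_rankLE_of_perm`, `stabilizer_count`: honoured BY
CONSTRUCTION — the stub asks for tori INSIDE the outer pieces and a middle that is charged in full (its witnesses
must have `H₂ ∩ N(H_outer) = 1`, `Stab_L S = H₁`, `Stab_R S = H₃`; the rigid pair has `|H₁||H₃| ≈ W/p²`, a full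
factor `p²` under the wall, so `stabilizer_count` leaves room `p^{O(1)}` exactly as TRIAGE-r1-3 computes);
`withoutTPP_holds` / `withoutIdTest_holds`: both hypotheses kept verbatim in `stub_rigidDesigns`;
`not_subgroupIdentityDesigns_levelZero/rankZeroMatrices/matOne`, `topLevel_slice_iff`: the family has
`k = 2ℓ ≥ 4`, `m = (n+2)ℓ ≥ 2k > k`; `no_idTest_of_torusCube` (Negative/TorusCube): the outer pieces carry NO
diagonal torus on the `U_k^∓` coordinates (the tori act on the Levi block only, fixed-point-freely), so no
`U_{k+1}`-coset cube with split-torus vertices sits in `H₁` or `H₃` — the middle must avoid creating one (M2);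
`no_idTest_of_pair_circuit`, `outer_pair_independent`, `mid_criterion`: milestones (M1), (M3) above;
`exists_idTest_volume_gt_finrank` (tightness, `S₃`): not used.  No `_false_without_` theorem names this line's
hypotheses; no landed `Negative/` lemma has an instance among the stubs (the pieces are not normalised by any
admissible middle: `N_{GL}(H₁) ≤ P⁻ ⋊ N(T₁)`).
-/

set_option linter.dupNamespace false

noncomputable section

open scoped BigOperators Classical
open Literature.RepresentationTheory.FiniteGroups
open Literature.Barriers.MatrixMultiplication
open Summit.MatrixMultiplication.MatrixMultiplication.Theorems.LieRankDesigns.Negative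
  (GLm Mat fourierFn RankSupp levelSet budget)

namespace Summit.MatrixMultiplication.MatrixMultiplication.Cruxes.SubgroupIdentityDesigns.LeviFreeRigidOuterPieces

open Summit.MatrixMultiplication.MatrixMultiplication.Theses.LevelGradedCohnUmans

/-! ## The crux in the tree's `LieRankDesigns.Negative.Basics` vocabulary (by `Iff.rfl`) -/

/-- The crux unfolds, by `Iff.rfl`, to `SubgroupTPP ∧ (identity test) ∧ budget < V^{(2+ε)/3}` with
`fourierFn`, `RankSupp`, `budget` of `Theorems.LieRankDesigns.Negative.Basics` (so nothing below drifts from the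
statement as filed). -/
theorem crux_iff :
    SubgroupIdentityDesigns ↔ ∀ ε : ℝ, 0 < ε → ∃ (p : ℕ) (_ : Fact p.Prime) (m k : ℕ)
      (H₁ H₂ H₃ : Subgroup (GLm p m)), SubgroupTPP H₁ H₂ H₃ ∧
        (∃ c : Mat p m → ℂ, RankSupp k c ∧ fourierFn c 1 = 1 ∧
          ∀ a ∈ H₁, ∀ b ∈ H₂, ∀ g ∈ H₃, a * b * g ≠ 1 → fourierFn c (a * b * g) = 0) ∧
        budget p m k (2 + ε) < ((Nat.card H₁ * Nat.card H₂ * Nat.card H₃ : ℕ) : ℝ) ^ ((2 + ε) / 3) :=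
  Iff.rfl

/-! ## The four registered stubs

Shapes (inlined in every signature so that a `Theorems/` file can prove a stub verbatim with only the tree's
vocabulary; `m = k + r`, rows/columns `< k` are `Fin.castAdd r i`, the Levi block is `Fin.natAdd k j`):
* LOWER piece of `T ≤ GL_r(𝔽_p)`: `g = [[u, 0], [X, t]]` — top-right block `0`, top-left block LOWER unitriangular
  (`g_ii = 1`, `g_ij = 0` for `i < j < k`), bottom-right block `= t ∈ T`, bottom-left block free;
* UPPER piece of `T`: `g = [[u, Z], [0, t]]` — bottom-left block `0`, top-left block UPPER unitriangular,
  bottom-right block `= t ∈ T`, top-right block free. -/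

/-- Statement of `stub_lowerPiece` (named copy, used as a hypothesis of the composition). -/
def LowerPieceStmt : Prop :=
  ∀ (p k r : ℕ) [Fact p.Prime] (T : Subgroup (GLm p r)),
      (∃ H : Subgroup (GLm p (k + r)), ∀ g : GLm p (k + r), g ∈ H ↔
        ((∀ (i : Fin (k)) (j : Fin (r)), (g : Mat p (k + r)) (Fin.castAdd (r) i) (Fin.natAdd (k) j) = 0) ∧
          (∀ i : Fin (k), (g : Mat p (k + r)) (Fin.castAdd (r) i) (Fin.castAdd (r) i) = 1) ∧
          (∀ i j : Fin (k), i < j → (g : Mat p (k + r)) (Fin.castAdd (r) i) (Fin.castAdd (r) j) = 0) ∧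
          (∃ t ∈ T, ∀ i j : Fin (r), (g : Mat p (k + r)) (Fin.natAdd (k) i) (Fin.natAdd (k) j) = (t : Mat p (r)) i j))) ∧
      (∀ H : Subgroup (GLm p (k + r)), (∀ g : GLm p (k + r), g ∈ H ↔
        ((∀ (i : Fin (k)) (j : Fin (r)), (g : Mat p (k + r)) (Fin.castAdd (r) i) (Fin.natAdd (k) j) = 0) ∧
          (∀ i : Fin (k), (g : Mat p (k + r)) (Fin.castAdd (r) i) (Fin.castAdd (r) i) = 1) ∧
          (∀ i j : Fin (k), i < j → (g : Mat p (k + r)) (Fin.castAdd (r) i) (Fin.castAdd (r) j) = 0) ∧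
          (∃ t ∈ T, ∀ i j : Fin (r), (g : Mat p (k + r)) (Fin.natAdd (k) i) (Fin.natAdd (k) j) = (t : Mat p (r)) i j))) →
        Nat.card H = p ^ (k.choose 2 + r * k) * Nat.card T)

/-- Statement of `stub_upperPiece`. -/
def UpperPieceStmt : Prop :=
  ∀ (p k r : ℕ) [Fact p.Prime] (T : Subgroup (GLm p r)),
      (∃ H : Subgroup (GLm p (k + r)), ∀ g : GLm p (k + r), g ∈ H ↔
        ((∀ (i : Fin (r)) (j : Fin (k)), (g : Mat p (k + r)) (Fin.natAdd (k) i) (Fin.castAdd (r) j) = 0) ∧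
          (∀ i : Fin (k), (g : Mat p (k + r)) (Fin.castAdd (r) i) (Fin.castAdd (r) i) = 1) ∧
          (∀ i j : Fin (k), j < i → (g : Mat p (k + r)) (Fin.castAdd (r) i) (Fin.castAdd (r) j) = 0) ∧
          (∃ t ∈ T, ∀ i j : Fin (r), (g : Mat p (k + r)) (Fin.natAdd (k) i) (Fin.natAdd (k) j) = (t : Mat p (r)) i j))) ∧
      (∀ H : Subgroup (GLm p (k + r)), (∀ g : GLm p (k + r), g ∈ H ↔
        ((∀ (i : Fin (r)) (j : Fin (k)), (g : Mat p (k + r)) (Fin.natAdd (k) i) (Fin.castAdd (r) j) = 0) ∧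
          (∀ i : Fin (k), (g : Mat p (k + r)) (Fin.castAdd (r) i) (Fin.castAdd (r) i) = 1) ∧
          (∀ i j : Fin (k), j < i → (g : Mat p (k + r)) (Fin.castAdd (r) i) (Fin.castAdd (r) j) = 0) ∧
          (∃ t ∈ T, ∀ i j : Fin (r), (g : Mat p (k + r)) (Fin.natAdd (k) i) (Fin.natAdd (k) j) = (t : Mat p (r)) i j))) →
        Nat.card H = p ^ (k.choose 2 + r * k) * Nat.card T)

/-- Statement of `stub_sharpBudget`. -/
def SharpBudgetStmt : Prop :=
  ∃ C : ℕ → ℕ → ℝ, (∀ m k : ℕ, 1 ≤ C m k) ∧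
      ∀ (p m k : ℕ) [Fact p.Prime] (s : ℝ), 1 ≤ k → 2 * k ≤ m → 2 ≤ s →
        budget p m k s ≤ C m k ^ s * (p : ℝ) ^ (s * ((m : ℝ) * k - (k : ℝ) ^ 2 / 2 - k / 2) + k)

/-- Statement of `stub_rigidDesigns` (the transfer target `C⁺` of the card, sharpened by the triage). -/
def RigidDesignsStmt : Prop :=
  ∃ a : ℕ, ∀ ℓ₀ : ℕ, ∃ ℓ : ℕ, ℓ₀ ≤ ℓ ∧ 2 ≤ ℓ ∧ ∃ n : ℕ, 2 ≤ n ∧ ∃ c : ℝ, 0 < c ∧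
      ∀ p₀ : ℕ, ∃ p : ℕ, p₀ ≤ p ∧ ∃ _ : Fact p.Prime, ∃ T₁ T₃ : Subgroup (GLm p (ℓ * n)),
        (∀ t ∈ T₁, t ≠ 1 → IsUnit ((t : Mat p (ℓ * n)) - 1)) ∧
        (∀ t ∈ T₃, t ≠ 1 → IsUnit ((t : Mat p (ℓ * n)) - 1)) ∧
        p ^ (ℓ - 1) ≤ Nat.card T₁ ∧ p ^ (ℓ - 1) ≤ Nat.card T₃ ∧
        ∀ H₁ H₃ : Subgroup (GLm p (2 * ℓ + ℓ * n)),
          (∀ g : GLm p (2 * ℓ + ℓ * n), g ∈ H₁ ↔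
          ((∀ (i : Fin (2 * ℓ)) (j : Fin (ℓ * n)), (g : Mat p (2 * ℓ + ℓ * n)) (Fin.castAdd (ℓ * n) i) (Fin.natAdd (2 * ℓ) j) = 0) ∧
          (∀ i : Fin (2 * ℓ), (g : Mat p (2 * ℓ + ℓ * n)) (Fin.castAdd (ℓ * n) i) (Fin.castAdd (ℓ * n) i) = 1) ∧
          (∀ i j : Fin (2 * ℓ), i < j → (g : Mat p (2 * ℓ + ℓ * n)) (Fin.castAdd (ℓ * n) i) (Fin.castAdd (ℓ * n) j) = 0) ∧
          (∃ t ∈ T₁, ∀ i j : Fin (ℓ * n), (g : Mat p (2 * ℓ + ℓ * n)) (Fin.natAdd (2 * ℓ) i) (Fin.natAdd (2 * ℓ) j) = (t : Mat p (ℓ * n)) i j))) →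
          (∀ g : GLm p (2 * ℓ + ℓ * n), g ∈ H₃ ↔
          ((∀ (i : Fin (ℓ * n)) (j : Fin (2 * ℓ)), (g : Mat p (2 * ℓ + ℓ * n)) (Fin.natAdd (2 * ℓ) i) (Fin.castAdd (ℓ * n) j) = 0) ∧
          (∀ i : Fin (2 * ℓ), (g : Mat p (2 * ℓ + ℓ * n)) (Fin.castAdd (ℓ * n) i) (Fin.castAdd (ℓ * n) i) = 1) ∧
          (∀ i j : Fin (2 * ℓ), j < i → (g : Mat p (2 * ℓ + ℓ * n)) (Fin.castAdd (ℓ * n) i) (Fin.castAdd (ℓ * n) j) = 0) ∧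
          (∃ t ∈ T₃, ∀ i j : Fin (ℓ * n), (g : Mat p (2 * ℓ + ℓ * n)) (Fin.natAdd (2 * ℓ) i) (Fin.natAdd (2 * ℓ) j) = (t : Mat p (ℓ * n)) i j))) →
          ∃ H₂ : Subgroup (GLm p (2 * ℓ + ℓ * n)),
            SubgroupTPP H₁ H₂ H₃ ∧
            (∃ c : Mat p (2 * ℓ + ℓ * n) → ℂ, RankSupp (2 * ℓ) c ∧ fourierFn c 1 = 1 ∧
              ∀ a ∈ H₁, ∀ b ∈ H₂, ∀ g ∈ H₃, a * b * g ≠ 1 → fourierFn c (a * b * g) = 0) ∧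
            c * (p : ℝ) ^ (2 * (ℓ : ℝ) ^ 2 * (n + 1) - a) ≤ Nat.card H₂

/-- **STUB (M) — the lower rigid piece is a subgroup of the stated order.**  For every prime `p`, all `k, r` and
EVERY subgroup `T ≤ GL_r(𝔽_p)`, the set `{g = [[u,0],[X,t]] : u ∈ U_k⁻ lower unitriangular, X ∈ M_{r×k}(𝔽_p),
t ∈ T}` is (the carrier of) a subgroup of `GL_{k+r}(𝔽_p)` — block multiplication:
`[[u,0],[X,t]]·[[u',0],[X',t']] = [[uu',0],[Xu'+tX', tt']]`; a product-closed subset of a finite group containing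
`1` is a subgroup (tree pattern `exists_subgroup_of_mul_mem`, StubSharpLevelDegree) — and its order is
`p^{C(k,2)} · p^{rk} · |T|` (free strictly-lower entries of `u`, free `X`, `t ∈ T`; the map `g ↦ (u, X, t)` is a
bijection). [folklore; card levi-free-rigid-outer-pieces "(iii) Numbers"] -/
theorem stub_lowerPiece :
    ∀ (p k r : ℕ) [Fact p.Prime] (T : Subgroup (GLm p r)),
      (∃ H : Subgroup (GLm p (k + r)), ∀ g : GLm p (k + r), g ∈ H ↔
        ((∀ (i : Fin (k)) (j : Fin (r)), (g : Mat p (k + r)) (Fin.castAdd (r) i) (Fin.natAdd (k) j) = 0) ∧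
          (∀ i : Fin (k), (g : Mat p (k + r)) (Fin.castAdd (r) i) (Fin.castAdd (r) i) = 1) ∧
          (∀ i j : Fin (k), i < j → (g : Mat p (k + r)) (Fin.castAdd (r) i) (Fin.castAdd (r) j) = 0) ∧
          (∃ t ∈ T, ∀ i j : Fin (r), (g : Mat p (k + r)) (Fin.natAdd (k) i) (Fin.natAdd (k) j) = (t : Mat p (r)) i j))) ∧
      (∀ H : Subgroup (GLm p (k + r)), (∀ g : GLm p (k + r), g ∈ H ↔
        ((∀ (i : Fin (k)) (j : Fin (r)), (g : Mat p (k + r)) (Fin.castAdd (r) i) (Fin.natAdd (k) j) = 0) ∧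
          (∀ i : Fin (k), (g : Mat p (k + r)) (Fin.castAdd (r) i) (Fin.castAdd (r) i) = 1) ∧
          (∀ i j : Fin (k), i < j → (g : Mat p (k + r)) (Fin.castAdd (r) i) (Fin.castAdd (r) j) = 0) ∧
          (∃ t ∈ T, ∀ i j : Fin (r), (g : Mat p (k + r)) (Fin.natAdd (k) i) (Fin.natAdd (k) j) = (t : Mat p (r)) i j))) →
        Nat.card H = p ^ (k.choose 2 + r * k) * Nat.card T) :=
  -- LANDED (worker, p118420): Theorems/LevelGradedCohnUmansSubgroupIdentityDesignsStubLowerPiece.lean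
  Summit.MatrixMultiplication.MatrixMultiplication.Theorems.LeviFreeRigidOuterPieces.stub_lowerPiece

/-- **STUB (M) — the upper rigid piece is a subgroup of the stated order.**  Same as `stub_lowerPiece` for
`{g = [[u,Z],[0,t]] : u ∈ U_k⁺ upper unitriangular, Z ∈ M_{k×r}(𝔽_p), t ∈ T}`; it is the image of the lower piece
of `Tᵀ = {tᵀ}` under the anti-automorphism `g ↦ gᵀ`, so it follows from `stub_lowerPiece` applied to `Tᵀ`
(`Matrix.transpose_mul`, `Matrix.rank`-free). [folklore] -/
theorem stub_upperPiece :
    ∀ (p k r : ℕ) [Fact p.Prime] (T : Subgroup (GLm p r)),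
      (∃ H : Subgroup (GLm p (k + r)), ∀ g : GLm p (k + r), g ∈ H ↔
        ((∀ (i : Fin (r)) (j : Fin (k)), (g : Mat p (k + r)) (Fin.natAdd (k) i) (Fin.castAdd (r) j) = 0) ∧
          (∀ i : Fin (k), (g : Mat p (k + r)) (Fin.castAdd (r) i) (Fin.castAdd (r) i) = 1) ∧
          (∀ i j : Fin (k), j < i → (g : Mat p (k + r)) (Fin.castAdd (r) i) (Fin.castAdd (r) j) = 0) ∧
          (∃ t ∈ T, ∀ i j : Fin (r), (g : Mat p (k + r)) (Fin.natAdd (k) i) (Fin.natAdd (k) j) = (t : Mat p (r)) i j))) ∧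
      (∀ H : Subgroup (GLm p (k + r)), (∀ g : GLm p (k + r), g ∈ H ↔
        ((∀ (i : Fin (r)) (j : Fin (k)), (g : Mat p (k + r)) (Fin.natAdd (k) i) (Fin.castAdd (r) j) = 0) ∧
          (∀ i : Fin (k), (g : Mat p (k + r)) (Fin.castAdd (r) i) (Fin.castAdd (r) i) = 1) ∧
          (∀ i j : Fin (k), j < i → (g : Mat p (k + r)) (Fin.castAdd (r) i) (Fin.castAdd (r) j) = 0) ∧
          (∃ t ∈ T, ∀ i j : Fin (r), (g : Mat p (k + r)) (Fin.natAdd (k) i) (Fin.natAdd (k) j) = (t : Mat p (r)) i j))) →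
        Nat.card H = p ^ (k.choose 2 + r * k) * Nat.card T) :=
  -- LANDED (worker, p118612): Theorems/LevelGradedCohnUmansSubgroupIdentityDesignsStubUpperPiece.lean
  Summit.MatrixMultiplication.MatrixMultiplication.Theorems.LeviFreeRigidOuterPieces.stub_upperPiece

/-- **STUB (named fact, blocked) — Green's degree bound for `GL_n(𝔽_p)`.**  Every irreducible complex character
of `GL_n(𝔽_p)` has degree `≤ 2^n · p^{n(n-1)/2}` (Green 1955; Macdonald 1995 Ch. IV §6 (6.7)–(6.8)).  This is the
tree's NAMED FACT `Literature.RepresentationTheory.FiniteGroups.GreenGLnDegreeBound` (statement only, no proof in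
the tree: Green's theory / Deligne–Lusztig is far from Mathlib).  It is registered as its own stub so that the line
is honestly "closed modulo Green": the sharp level-`k` budget below needs the SHARP maximal degree of `GL_k(𝔽_p)`
(`≤ C_k p^{k(k-1)/2}`); the trivial bound `d < |GL_k|^{1/2} < p^{k²/2}` loses `p^{k/2}`, which is fatal for this
line (its volume sits a fixed power `p^{2+a}` under `W^{3/2}`, so a budget loss `p^{(s-2)k/2} = p^{εℓ}` eats the
whole exponent gap `ℓε − (2+ε)(2+a)/3`).  [Green 1955; Macdonald1995 Ch. IV §6] -/
theorem stub_green : Literature.RepresentationTheory.FiniteGroups.GreenGLnDegreeBound := by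
  sorry

/-- **STUB (L) — the SHARP level-`k` budget of `GL_m(𝔽_p)`, from Green's degree bound.**  Assuming
`GreenGLnDegreeBound`, there are constants `C_{m,k} ≥ 1` with
`budget p m k s = Σ_{χ ∈ Irr(GL_m(𝔽_p)) ∩ F_k} χ(1)^s ≤ C_{m,k}^s · p^{s(mk - k²/2 - k/2) + k}` for all primes `p`,
`1 ≤ k`, `2k ≤ m`, real `s ≥ 2` (Gurevich–Howe arXiv:1609.01276, Thm 15/21: the tensor-rank-`≤ k` irreducibles have
dimension `≍ p^{k(m-k)} · dim(GL_k-irrep) ≤ 2^k p^{mk-k²/2-k/2}` and there are `≍ p^k` of them).  Elementary route: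
`Σ χ(1)^s ≤ d_max^{s-2} · Σ_{Irr ∩ F_k} χ(1)²`, with (a) `d_max ≤ 2^{m+k} p^{mk-k²/2-k/2}` = the tree's
`Theorems.LieRankDesigns.stub_sharpLevelDegree` (LANDED, file
`Theorems/LevelGradedCohnUmansLieRankDesignsStubSharpLevelDegree.lean`; its hypothesis is literally
`GreenGLnDegreeBound` unfolded), (b) `Σ_{Irr ∩ F_k} χ(1)² ≤ dim F_k|_G` (a bi-invariant `J` contains the Wedderburn
block `M_{d}` of each irreducible character lying in it: `Negative.GradedPlancherel.finrank_repFun_le` /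
`GradedPricing` line's `stub_support`, `stub_expansion`), (c) `dim F_k|_G ≤ N_k = #{M : rk M ≤ k} ≤ C'_{m,k} p^{2mk-k²}`
(`finrank_levelSubmodule_le` of `Cruxes/SubgroupIdentityDesigns/Disproof.lean` + the count of rank-`≤ k` matrices,
cf. `stub_parabolicFacts`), and `2mk - k² = 2(mk - k²/2 - k/2) + k`.  The landed `cellBudget_of_stubs`
(`LieRankDesigns` line) is the same inequality with the weaker saving `(p-1)^{(s-2)/2}` and does NOT suffice here.
[GurevichHowe2017 Thm 21; Green 1955] -/
theorem stub_sharpBudget_of_green :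
    Literature.RepresentationTheory.FiniteGroups.GreenGLnDegreeBound →
    ∃ C : ℕ → ℕ → ℝ, (∀ m k : ℕ, 1 ≤ C m k) ∧
      ∀ (p m k : ℕ) [Fact p.Prime] (s : ℝ), 1 ≤ k → 2 * k ≤ m → 2 ≤ s →
        budget p m k s ≤ C m k ^ s * (p : ℝ) ^ (s * ((m : ℝ) * k - (k : ℝ) ^ 2 / 2 - k / 2) + k) :=
  -- LANDED (worker, p118412): Theorems/LevelGradedCohnUmansSubgroupIdentityDesignsStubSharpBudgetOfGreen.lean
  Summit.MatrixMultiplication.MatrixMultiplication.Theorems.LeviFreeRigidOuterPieces.stub_sharpBudget_of_green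

/-- The sharp level-`k` budget (`SharpBudgetStmt`), assembled from the two registered stubs `stub_green`
(named fact) and `stub_sharpBudget_of_green`. -/
theorem stub_sharpBudget :
    ∃ C : ℕ → ℕ → ℝ, (∀ m k : ℕ, 1 ≤ C m k) ∧
      ∀ (p m k : ℕ) [Fact p.Prime] (s : ℝ), 1 ≤ k → 2 * k ≤ m → 2 ≤ s →
        budget p m k s ≤ C m k ^ s * (p : ℝ) ^ (s * ((m : ℝ) * k - (k : ℝ) ^ 2 / 2 - k / 2) + k) :=
  stub_sharpBudget_of_green stub_green

/-- **STUB (XL, hardest; the transfer target `C⁺ = RigidDesigns`) — rigid outer pieces admit a transverse middle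
passing the level-`2ℓ` identity test, with a FIXED power loss.**  For some `a : ℕ`, for unboundedly many `ℓ ≥ 2`
(`k = 2ℓ`), some `n ≥ 2` (`m = k + ℓn`; take `n ≥ 3`, even `n ≥ 2k`, for TPP genericity and the normaliser
arithmetic of the card) and some `c > 0`, for unboundedly many primes `p`: there are FIXED-POINT-FREE subgroups
`T₁, T₃ ≤ GL_{ℓn}(𝔽_p)` of order `≥ p^{ℓ-1}` (intended: scalar-free subfield tori `𝔽_{p^ℓ}^×/𝔽_p^×` for two
`𝔽_{p^ℓ}`-structures on `𝔽_p^{ℓn}` in general position, `gcd(ℓ, p-1) = 1`) such that the rigid outer pair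
`H₁ = T₁ ⋉ U⁻_{cols ≤ k}`, `H₃ = T₃ ⋉ U⁺_{rows ≤ k}` (the unique subgroups with the two membership predicates, which
exist by `stub_lowerPiece` / `stub_upperPiece`) admits a middle group `H₂` with (i) `SubgroupTPP H₁ H₂ H₃`, (ii) the
level-`2ℓ` identity test — ONE Fourier table `c` of rank support `≤ 2ℓ` with `f_c(1) = 1`, `f_c(abg) = 0` for
`abg ≠ 1` — and (iii) `|H₂| ≥ c · p^{2ℓ²(n+1) - a}` (`a = 0`: `|H₂| ≈ √W`, `V ≈ W^{3/2}/p²`, `s > 6k/(3k-4)`;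
the walls allow up to `a = -1`).  LEAD'S FINDING (M1, kernel-checked: `Theorems/SubgroupIdentityDesigns/Negative/
LeviCollision.lean`, `…/LeviCollisionRigidPair.lean`: `rigidPair_no_idTest_of_le`): for `r = ℓn ≥ 2k = 4ℓ`, i.e.
`n ≥ 4`, the conclusion is FALSE for every `T₁ ≠ 1` and every `H₂` (Levi collision: an explicit level-`2ℓ`
annihilator on `H₁H₃`); witnesses, if any, have `n ∈ {2, 3}`, and at `n = 3` every `x ∈ T₁T₃ ∖ 1` must have
`rk(x - 1) ≥ 2ℓ + 1` (`rigidPair_no_idTest_of_leviCollision`); at `n = 2` TPP is dimensionally non-generic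
(`V > |G|`).  WHY IT MIGHT FAIL: no identity-test mechanism is known at any `k ≥ 2`; a GENERIC
transverse middle is overdetermined in every generic `(U_P⁻, U_P⁺)`-type by `≈ |H₂|/p²` (TRIAGE-r1-3, Bessel count),
so `H₂` must have a small Levi double-coset footprint; the standing conjecture of `Disproof.lean` "`k < m ⇒ V ≤
dim F_k`" would kill it (and every sandwich line) at once.  Necessary filters its witnesses pass automatically:
`H₂ ∩ (N(H₁) ∪ N(H₃)) = 1`, `H₂` scalar-free, exact stabilisers, the pair test (M1), M11 (M3).
[card levi-free-rigid-outer-pieces, Transfer; TRIAGE-r1-1/2/3; BlasiakCohnGrochowPrattUmans2023 Thm 3.6;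
GurevichHowe2017] -/
theorem stub_rigidDesigns :
    ∃ a : ℕ, ∀ ℓ₀ : ℕ, ∃ ℓ : ℕ, ℓ₀ ≤ ℓ ∧ 2 ≤ ℓ ∧ ∃ n : ℕ, 2 ≤ n ∧ ∃ c : ℝ, 0 < c ∧
      ∀ p₀ : ℕ, ∃ p : ℕ, p₀ ≤ p ∧ ∃ _ : Fact p.Prime, ∃ T₁ T₃ : Subgroup (GLm p (ℓ * n)),
        (∀ t ∈ T₁, t ≠ 1 → IsUnit ((t : Mat p (ℓ * n)) - 1)) ∧
        (∀ t ∈ T₃, t ≠ 1 → IsUnit ((t : Mat p (ℓ * n)) - 1)) ∧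
        p ^ (ℓ - 1) ≤ Nat.card T₁ ∧ p ^ (ℓ - 1) ≤ Nat.card T₃ ∧
        ∀ H₁ H₃ : Subgroup (GLm p (2 * ℓ + ℓ * n)),
          (∀ g : GLm p (2 * ℓ + ℓ * n), g ∈ H₁ ↔
          ((∀ (i : Fin (2 * ℓ)) (j : Fin (ℓ * n)), (g : Mat p (2 * ℓ + ℓ * n)) (Fin.castAdd (ℓ * n) i) (Fin.natAdd (2 * ℓ) j) = 0) ∧
          (∀ i : Fin (2 * ℓ), (g : Mat p (2 * ℓ + ℓ * n)) (Fin.castAdd (ℓ * n) i) (Fin.castAdd (ℓ * n) i) = 1) ∧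
          (∀ i j : Fin (2 * ℓ), i < j → (g : Mat p (2 * ℓ + ℓ * n)) (Fin.castAdd (ℓ * n) i) (Fin.castAdd (ℓ * n) j) = 0) ∧
          (∃ t ∈ T₁, ∀ i j : Fin (ℓ * n), (g : Mat p (2 * ℓ + ℓ * n)) (Fin.natAdd (2 * ℓ) i) (Fin.natAdd (2 * ℓ) j) = (t : Mat p (ℓ * n)) i j))) →
          (∀ g : GLm p (2 * ℓ + ℓ * n), g ∈ H₃ ↔
          ((∀ (i : Fin (ℓ * n)) (j : Fin (2 * ℓ)), (g : Mat p (2 * ℓ + ℓ * n)) (Fin.natAdd (2 * ℓ) i) (Fin.castAdd (ℓ * n) j) = 0) ∧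
          (∀ i : Fin (2 * ℓ), (g : Mat p (2 * ℓ + ℓ * n)) (Fin.castAdd (ℓ * n) i) (Fin.castAdd (ℓ * n) i) = 1) ∧
          (∀ i j : Fin (2 * ℓ), j < i → (g : Mat p (2 * ℓ + ℓ * n)) (Fin.castAdd (ℓ * n) i) (Fin.castAdd (ℓ * n) j) = 0) ∧
          (∃ t ∈ T₃, ∀ i j : Fin (ℓ * n), (g : Mat p (2 * ℓ + ℓ * n)) (Fin.natAdd (2 * ℓ) i) (Fin.natAdd (2 * ℓ) j) = (t : Mat p (ℓ * n)) i j))) →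
          ∃ H₂ : Subgroup (GLm p (2 * ℓ + ℓ * n)),
            SubgroupTPP H₁ H₂ H₃ ∧
            (∃ c : Mat p (2 * ℓ + ℓ * n) → ℂ, RankSupp (2 * ℓ) c ∧ fourierFn c 1 = 1 ∧
              ∀ a ∈ H₁, ∀ b ∈ H₂, ∀ g ∈ H₃, a * b * g ≠ 1 → fourierFn c (a * b * g) = 0) ∧
            c * (p : ℝ) ^ (2 * (ℓ : ℝ) ^ 2 * (n + 1) - a) ≤ Nat.card H₂ := by
  sorry

/-! ## Real-exponent bookkeeping helpers -/

/-- `C(2ℓ, 2) = 2ℓ² - ℓ` over `ℝ`. -/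
theorem cast_choose_two_mul (ℓ : ℕ) : (((2 * ℓ).choose 2 : ℕ) : ℝ) = 2 * (ℓ : ℝ) ^ 2 - ℓ := by
  have h : (2 * ℓ).choose 2 = ℓ * (2 * ℓ - 1) := by
    rw [Nat.choose_two_right, mul_assoc, Nat.mul_div_cancel_left _ (by norm_num : 0 < 2)]
  rw [h]
  rcases Nat.eq_zero_or_pos ℓ with rfl | hℓ
  · simp
  · rw [Nat.cast_mul, Nat.cast_sub (by omega : 1 ≤ 2 * ℓ)]
    push_cast
    ring

/-- The order of a rigid piece, `p^{C(2ℓ,2) + (ℓn)(2ℓ)} · |T|` with `|T| ≥ p^{ℓ-1}`, is at least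
`p^{2ℓ²(n+1) - 1}` (as a real power). -/
theorem piece_card_lower_bound {p ℓ n N t : ℕ} (hℓ : 1 ≤ ℓ)
    (hN : N = p ^ ((2 * ℓ).choose 2 + ℓ * n * (2 * ℓ)) * t) (ht : p ^ (ℓ - 1) ≤ t) :
    (p : ℝ) ^ (2 * (ℓ : ℝ) ^ 2 * (n + 1) - 1) ≤ (N : ℝ) := by
  have h1 : p ^ ((2 * ℓ).choose 2 + ℓ * n * (2 * ℓ) + (ℓ - 1)) ≤ N := by
    rw [hN, pow_add]
    exact Nat.mul_le_mul_left _ ht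
  have h2 : (((2 * ℓ).choose 2 + ℓ * n * (2 * ℓ) + (ℓ - 1) : ℕ) : ℝ) = 2 * (ℓ : ℝ) ^ 2 * (n + 1) - 1 := by
    rw [Nat.cast_add, Nat.cast_add, cast_choose_two_mul, Nat.cast_sub hℓ]
    push_cast
    ring
  calc (p : ℝ) ^ (2 * (ℓ : ℝ) ^ 2 * (n + 1) - 1)
      = (p : ℝ) ^ ((((2 * ℓ).choose 2 + ℓ * n * (2 * ℓ) + (ℓ - 1) : ℕ)) : ℝ) := by rw [h2]
    _ = ((p ^ ((2 * ℓ).choose 2 + ℓ * n * (2 * ℓ) + (ℓ - 1)) : ℕ) : ℝ) := by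
        rw [Real.rpow_natCast, Nat.cast_pow]
    _ ≤ N := by exact_mod_cast h1

/-! ## The composition: the four stubs close the crux BY NAME -/

/-- **The line closes the crux** (ε-bookkeeping, kernel-checked).  Given `ε > 0` put `s = 2 + ε`; take the loss
`a` of `RigidDesignsStmt`, a level parameter `ℓ > (2+ε)(2+a)/(3ε)` in the family, its `n, c`, the budget constant
`C = C_{m,k}` (`m = 2ℓ + ℓn`, `k = 2ℓ`), `δ := ℓε − (2+ε)(2+a)/3 > 0`, `K := C^s / c^{s/3}` and a prime `p > K^{1/δ}`
of the family.  The pieces have `|H₁|, |H₃| ≥ p^{2ℓ²(n+1)-1}` (`stub_lower/upperPiece`), so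
`V ≥ c·p^{6ℓ²(n+1) - 2 - a}` and `V^{s/3} ≥ c^{s/3} p^{s(2ℓ²(n+1)) - s(2+a)/3}`, while
`budget ≤ C^s p^{s(2ℓ²(n+1) - ℓ) + 2ℓ}` (`stub_sharpBudget`); the exponents differ by exactly `δ` and
`C^s = K c^{s/3} < p^δ c^{s/3}`. -/
theorem SubgroupIdentityDesigns_of :
    LowerPieceStmt → UpperPieceStmt → SharpBudgetStmt → RigidDesignsStmt → SubgroupIdentityDesigns := by
  intro hLow hUp hBud hDes
  rw [crux_iff]
  intro ε hε
  obtain ⟨C, hC1, hbudget⟩ := hBud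
  obtain ⟨a, hfam⟩ := hDes
  -- Step 1: the level parameter `ℓ`, large enough for a positive exponent gap `δ`
  obtain ⟨ℓ₀, hℓ₀⟩ := exists_nat_gt ((2 + ε) * (2 + a) / (3 * ε))
  obtain ⟨ℓ, hℓℓ₀, hℓ2, n, hn2, c, hc, hall⟩ := hfam ℓ₀
  have hℓ1 : 1 ≤ ℓ := le_trans (by norm_num) hℓ2
  have hδ : 0 < (ℓ : ℝ) * ε - (2 + ε) * (2 + a) / 3 := by
    have h1 : (2 + ε) * (2 + a) / (3 * ε) < ℓ := lt_of_lt_of_le hℓ₀ (by exact_mod_cast hℓℓ₀)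
    have h2 : (2 + ε) * (2 + a) < ℓ * (3 * ε) := (div_lt_iff₀ (by positivity)).1 h1
    have h3 : (2 + ε) * (2 + a) / 3 < ℓ * ε := by
      rw [div_lt_iff₀ (by norm_num : (0 : ℝ) < 3)]
      linarith
    linarith
  set δ : ℝ := (ℓ : ℝ) * ε - (2 + ε) * (2 + a) / 3 with hδ_def
  -- Step 2: the budget constant and the prime `p`
  have hk1 : 1 ≤ 2 * ℓ := by omega
  have hkm : 2 * (2 * ℓ) ≤ 2 * ℓ + ℓ * n := by
    calc 2 * (2 * ℓ) = 2 * ℓ + ℓ * 2 := by ring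
      _ ≤ 2 * ℓ + ℓ * n := by gcongr
  have hs2 : (2 : ℝ) ≤ 2 + ε := by linarith
  have hs0 : (0 : ℝ) < 2 + ε := by linarith
  set Cb : ℝ := C (2 * ℓ + ℓ * n) (2 * ℓ) with hCb_def
  have hCb1 : 1 ≤ Cb := hC1 _ _
  have hCb0 : 0 < Cb := lt_of_lt_of_le one_pos hCb1
  set K : ℝ := Cb ^ (2 + ε) / c ^ ((2 + ε) / 3) with hK_def
  have hcs : 0 < c ^ ((2 + ε) / 3) := Real.rpow_pos_of_pos hc _
  have hK0 : 0 < K := div_pos (Real.rpow_pos_of_pos hCb0 _) hcs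
  obtain ⟨N, hN⟩ := exists_nat_gt (max 2 (K ^ (1 / δ)))
  obtain ⟨p, hNp, hp, T₁, T₃, _hT₁f, _hT₃f, hT₁c, hT₃c, hmid⟩ := hall N
  have hNR : (N : ℝ) ≤ p := by exact_mod_cast hNp
  have hp2 : (2 : ℝ) < p := lt_of_lt_of_le (lt_of_le_of_lt (le_max_left _ _) hN) hNR
  have hpK : K ^ (1 / δ) < p := lt_of_lt_of_le (lt_of_le_of_lt (le_max_right _ _) hN) hNR
  have hp0 : (0 : ℝ) < p := by linarith
  have hKp : K < (p : ℝ) ^ δ := by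
    have h1 : (K ^ (1 / δ)) ^ δ < (p : ℝ) ^ δ := Real.rpow_lt_rpow (by positivity) hpK hδ
    have h2 : (K ^ (1 / δ)) ^ δ = K := by
      rw [← Real.rpow_mul hK0.le, one_div_mul_cancel hδ.ne', Real.rpow_one]
    rwa [h2] at h1
  -- Step 3: the outer pieces (from the piece stubs) and the middle (from the design stub)
  obtain ⟨⟨H₁, hH₁⟩, hcard₁⟩ := hLow p (2 * ℓ) (ℓ * n) T₁
  obtain ⟨⟨H₃, hH₃⟩, hcard₃⟩ := hUp p (2 * ℓ) (ℓ * n) T₃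
  have hc₁ : Nat.card H₁ = p ^ ((2 * ℓ).choose 2 + ℓ * n * (2 * ℓ)) * Nat.card T₁ := hcard₁ H₁ hH₁
  have hc₃ : Nat.card H₃ = p ^ ((2 * ℓ).choose 2 + ℓ * n * (2 * ℓ)) * Nat.card T₃ := hcard₃ H₃ hH₃
  obtain ⟨H₂, htpp, htest, hH₂⟩ := hmid H₁ H₃ hH₁ hH₃
  refine ⟨p, hp, 2 * ℓ + ℓ * n, 2 * ℓ, H₁, H₂, H₃, htpp, htest, ?_⟩
  -- Step 4: the budget side
  have hB := hbudget p (2 * ℓ + ℓ * n) (2 * ℓ) (2 + ε) hk1 hkm hs2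
  have hEb : (2 + ε) * (((2 * ℓ + ℓ * n : ℕ) : ℝ) * ((2 * ℓ : ℕ) : ℝ) - ((2 * ℓ : ℕ) : ℝ) ^ 2 / 2 -
      ((2 * ℓ : ℕ) : ℝ) / 2) + ((2 * ℓ : ℕ) : ℝ) =
      (2 + ε) * (2 * (ℓ : ℝ) ^ 2 * (n + 1) - ℓ) + 2 * ℓ := by
    push_cast
    ring
  rw [hEb] at hB
  set E : ℝ := (2 + ε) * (2 * (ℓ : ℝ) ^ 2 * (n + 1) - ℓ) + 2 * ℓ with hE_def
  -- Step 5: the volume side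
  have hV₁ := piece_card_lower_bound (p := p) (n := n) hℓ1 hc₁ hT₁c
  have hV₃ := piece_card_lower_bound (p := p) (n := n) hℓ1 hc₃ hT₃c
  have hV : c * (p : ℝ) ^ (6 * (ℓ : ℝ) ^ 2 * (n + 1) - 2 - a) ≤
      ((Nat.card H₁ * Nat.card H₂ * Nat.card H₃ : ℕ) : ℝ) := by
    have e : c * (p : ℝ) ^ (6 * (ℓ : ℝ) ^ 2 * (n + 1) - 2 - a) =
        (p : ℝ) ^ (2 * (ℓ : ℝ) ^ 2 * (n + 1) - 1) * (c * (p : ℝ) ^ (2 * (ℓ : ℝ) ^ 2 * (n + 1) - a)) *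
          (p : ℝ) ^ (2 * (ℓ : ℝ) ^ 2 * (n + 1) - 1) := by
      have : (6 * (ℓ : ℝ) ^ 2 * (n + 1) - 2 - a) = (2 * (ℓ : ℝ) ^ 2 * (n + 1) - 1) +
          (2 * (ℓ : ℝ) ^ 2 * (n + 1) - a) + (2 * (ℓ : ℝ) ^ 2 * (n + 1) - 1) := by ring
      rw [this, Real.rpow_add hp0, Real.rpow_add hp0]
      ring
    rw [e]
    push_cast
    have h0₂ : (0 : ℝ) ≤ c * (p : ℝ) ^ (2 * (ℓ : ℝ) ^ 2 * (n + 1) - a) := by positivity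
    exact mul_le_mul (mul_le_mul hV₁ hH₂ h0₂ (by positivity)) hV₃ (by positivity) (by positivity)
  have hVs : (c * (p : ℝ) ^ (6 * (ℓ : ℝ) ^ 2 * (n + 1) - 2 - a)) ^ ((2 + ε) / 3) ≤
      ((Nat.card H₁ * Nat.card H₂ * Nat.card H₃ : ℕ) : ℝ) ^ ((2 + ε) / 3) :=
    Real.rpow_le_rpow (by positivity) hV (by positivity)
  have hVs' : (c * (p : ℝ) ^ (6 * (ℓ : ℝ) ^ 2 * (n + 1) - 2 - a)) ^ ((2 + ε) / 3) =
      c ^ ((2 + ε) / 3) * (p : ℝ) ^ (E + δ) := by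
    rw [Real.mul_rpow hc.le (by positivity), ← Real.rpow_mul hp0.le]
    congr 2
    rw [hE_def, hδ_def]
    ring
  -- Step 6: combine
  have hchain : Cb ^ (2 + ε) * (p : ℝ) ^ E < c ^ ((2 + ε) / 3) * (p : ℝ) ^ (E + δ) := by
    have hKc : Cb ^ (2 + ε) = K * c ^ ((2 + ε) / 3) := by
      rw [hK_def, div_mul_cancel₀ _ hcs.ne']
    have hpE : 0 < (p : ℝ) ^ E := Real.rpow_pos_of_pos hp0 _
    have hsplit : (p : ℝ) ^ (E + δ) = (p : ℝ) ^ E * (p : ℝ) ^ δ := Real.rpow_add hp0 E δ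
    calc Cb ^ (2 + ε) * (p : ℝ) ^ E = K * (c ^ ((2 + ε) / 3) * (p : ℝ) ^ E) := by rw [hKc]; ring
      _ < (p : ℝ) ^ δ * (c ^ ((2 + ε) / 3) * (p : ℝ) ^ E) :=
          mul_lt_mul_of_pos_right hKp (mul_pos hcs hpE)
      _ = c ^ ((2 + ε) / 3) * (p : ℝ) ^ (E + δ) := by rw [hsplit]; ring
  calc budget p (2 * ℓ + ℓ * n) (2 * ℓ) (2 + ε)
      ≤ Cb ^ (2 + ε) * (p : ℝ) ^ E := hB
    _ < c ^ ((2 + ε) / 3) * (p : ℝ) ^ (E + δ) := hchain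
    _ = (c * (p : ℝ) ^ (6 * (ℓ : ℝ) ^ 2 * (n + 1) - 2 - a)) ^ ((2 + ε) / 3) := hVs'.symm
    _ ≤ ((Nat.card H₁ * Nat.card H₂ * Nat.card H₃ : ℕ) : ℝ) ^ ((2 + ε) / 3) := hVs

/-- Type check: the four REGISTERED stubs are exactly the hypotheses of the composition, so together they
close the crux by name. -/
theorem subgroupIdentityDesigns_of_stubs : SubgroupIdentityDesigns :=
  SubgroupIdentityDesigns_of stub_lowerPiece stub_upperPiece stub_sharpBudget stub_rigidDesigns

end Summit.MatrixMultiplication.MatrixMultiplication.Cruxes.SubgroupIdentityDesigns.LeviFreeRigidOuterPieces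

end
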